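import Summits.KontsevichZagierPeriods.KontsevichZagierPeriods.Theorems.BiellipticRealPeriodCell.Negative.LemniscaticWitness
import Summits.KontsevichZagierPeriods.KontsevichZagierPeriods.Theorems.BiellipticRealPeriodCell.Negative.NoChangeOfVariables
import Summits.KontsevichZagierPeriods.KontsevichZagierPeriods.Theorems.XMapKernel.Negative.LandenRelator
import Literature.NumberTheory.Transcendental.ManyCurveThetaClassification
import Literature.NumberTheory.Transcendental.KontsevichZagierGammaProofs

/-!
# `BiellipticRealPeriodCell` (stmt-KontsevichZagierPeriods-18685) — negative knowledge, part 5: rule (2) is load-bearing, unconditionally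

Support file for the crux `IsogenyCertificates.BiellipticRealPeriodCell` (cdisprove seat, cycle 1;
work file `Cruxes/BiellipticRealPeriodCell/Disproof.lean`, finding F6), over part 3
(`NoChangeOfVariables`: every element of the change-of-variables-free sub-calculus
`closure((1a) ∪ (1b) ∪ (3))` has ALGEBRAIC restricted value over the first-coordinate windows) and
part 4 (`LemniscaticWitness`: the odd generators `[K₊, x/√F₁]`, `[K₋, x/√F₁]` on
`y² = (x²−1)(x²−25)(x²−49)` exist, with values `V`, `−V`).

* §16 `V = ϖ/(2√24)`: ONE substitution `u = x²` (`MeasureTheory.integral_image_eq_integral_abs_deriv_smul`: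
  `∫₁²⁵ du/√G₁(u) = 2V`), ONE affine map `u = 24X + 25` (`G₁(24X+25) = 24³(X³−X)`:
  `∫₁²⁵ du/√G₁ = (√24)⁻¹ ∫₋₁⁰ dX/√(X³−X)`) and the tree's lemniscatic integral
  `∫₋₁⁰ dX/√(X³−X) = ϖ = Γ(1/4)²/(2√(2π))` (`XMapKernel.Negative.integral_Ioo_neg_one_zero`);
* §17 `ϖ` is TRANSCENDENTAL (`transcendental_halfLem`) — Schneider's theorem for the lemniscatic curve,
  obtained from the tree's Huber–Wüstholz theorem `HuberWustholzManyCurvePeriods_holds` with ONE curve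
  (the lemniscatic period pair, `exists_lemniscatic_periodPair`: `g₂ = 4`, `g₃ = 0`, `ω₁ = ϖ`): a
  relation `α + 1·ω₁ = 0` with `α` algebraic forces `α = 0`; hence `V` is transcendental;
* §18 **`false_without_changeOfVariables`** — the crux with `KZ.relations` replaced by the subgroup
  generated by (1a), (1b), (3) is FALSE: the odd pair `[K₊, x/√F₁] + [K₋, x/√F₁]` is a value-`0`
  element of the sector whose restricted value `−V` is transcendental. Together with part 2
  (`false_without_additivity`, `false_without_cov_nl`): ANY proof of `BiellipticRealPeriodCell` uses
  an additivity rule AND a change of variables; Newton–Leibniz alone cannot replace either.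
No statement of the tree is changed and no definition is introduced. [Kontsevich–Zagier 2001, §1.2]
[Huber–Wüstholz 2022, Thm 15.3] [folklore]
-/

noncomputable section

open Set MeasureTheory MvPolynomial
open Literature.NumberTheory.Transcendental Literature.ModelTheory.ExponentialFields
open Summit.KontsevichZagierPeriods.KontsevichZagierPeriods.Theses.IsogenyCertificates

namespace Summit.KontsevichZagierPeriods.IsogenyCertificates.BiellipticRealPeriodCellNegative

/-! ### §16 The value `V = ∫₁⁵ x dx/√F₁ = ϖ/(2√24)` — one substitution `u = x²`, one affine map, the tree's lemniscatic integral -/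

/-- Squaring maps `(1,5)` onto `(1,25)`. [folklore] -/
theorem image_sq_Ioo_one_five : (fun x : ℝ => x ^ 2) '' Ioo (1:ℝ) 5 = Ioo 1 25 := by
  ext u
  simp only [mem_image, mem_Ioo]
  constructor
  · rintro ⟨x, hx, rfl⟩
    exact ⟨by nlinarith [hx.1], by nlinarith [hx.1, hx.2]⟩
  · rintro ⟨h1, h25⟩
    have hu : 0 ≤ u := by linarith
    refine ⟨Real.sqrt u, ⟨?_, ?_⟩, Real.sq_sqrt hu⟩
    · rw [show (1:ℝ) = Real.sqrt 1 from Real.sqrt_one.symm]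
      exact Real.sqrt_lt_sqrt (by norm_num) h1
    · rw [show (5:ℝ) = Real.sqrt 25 by
        rw [show (25:ℝ) = 5 ^ 2 by norm_num, Real.sqrt_sq (by norm_num)]]
      exact Real.sqrt_lt_sqrt hu h25

/-- **Substitution `u = x²`** (the odd first-kind differential of the bielliptic curve is the pull-back
of `du/(2√G₁(u))` from `E₁ : y² = G₁(u)`):
`∫₁²⁵ du/√G₁(u) = 2 ∫₁⁵ x dx/√G₁(x²)` (`MeasureTheory.integral_image_eq_integral_abs_deriv_smul`).
[cite: KontsevichZagier2001, §1.2 rule (2)] -/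
theorem integral_sq_substitution :
    ∫ u in Ioo (1:ℝ) 25, 1 / Real.sqrt ((u - 1) * (u - 25) * (u - 49)) =
      2 * ∫ x in Ioo (1:ℝ) 5, x / Real.sqrt ((x ^ 2 - 1) * (x ^ 2 - 25) * (x ^ 2 - 49)) := by
  have hderiv : ∀ x ∈ Ioo (1:ℝ) 5, HasDerivWithinAt (fun x : ℝ => x ^ 2) (2 * x) (Ioo (1:ℝ) 5) x := by
    intro x _
    simpa using (hasDerivAt_pow 2 x).hasDerivWithinAt (s := Ioo (1:ℝ) 5)
  have hinj : InjOn (fun x : ℝ => x ^ 2) (Ioo (1:ℝ) 5) := fun x hx y hy hxy =>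
    (pow_left_inj₀ (by linarith [hx.1]) (by linarith [hy.1]) two_ne_zero).1 hxy
  rw [← image_sq_Ioo_one_five, integral_image_eq_integral_abs_deriv_smul measurableSet_Ioo hderiv hinj,
    ← integral_const_mul]
  refine setIntegral_congr_fun measurableSet_Ioo fun x hx => ?_
  have hx0 : 0 < x := by linarith [hx.1]
  rw [abs_of_pos (by linarith), smul_eq_mul]
  simp only [one_div]
  rw [div_eq_mul_inv]
  ring

/-- **Affine substitution `u = 24X + 25`**: `G₁(24X + 25) = 24³ (X³ − X)` (the roots `1, 25, 49`
are squares in arithmetic progression, so `E₁` is the quadratic twist by `24` of `y² = x³ − x`):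
`∫₁²⁵ du/√G₁(u) = (√24)⁻¹ ∫₋₁⁰ dX/√(X³ − X)`. [cite: KontsevichZagier2001, §1.2 rule (2)] -/
theorem integral_affine_substitution :
    ∫ u in Ioo (1:ℝ) 25, 1 / Real.sqrt ((u - 1) * (u - 25) * (u - 49)) =
      (Real.sqrt 24)⁻¹ * ∫ x in Ioo (-1:ℝ) 0, 1 / Real.sqrt (x ^ 3 - x) := by
  have hpt : ∀ x : ℝ, (fun u : ℝ => 1 / Real.sqrt ((u - 1) * (u - 25) * (u - 49))) (24 * x + 25) =
      (24 * Real.sqrt 24)⁻¹ * (1 / Real.sqrt (x ^ 3 - x)) := by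
    intro x
    have h24 : (0:ℝ) < Real.sqrt 24 := Real.sqrt_pos.2 (by norm_num)
    have hcube : (24 * x + 25 - 1) * (24 * x + 25 - 25) * (24 * x + 25 - 49) = (24 ^ 2 * 24) * (x ^ 3 - x) := by ring
    simp only []
    rw [hcube, Real.sqrt_mul (by norm_num), Real.sqrt_mul (by norm_num), Real.sqrt_sq (by norm_num)]
    rw [one_div, one_div, mul_inv, mul_inv]
  have h := intervalIntegral.integral_comp_mul_add (a := (-1:ℝ)) (b := 0)
    (fun u : ℝ => 1 / Real.sqrt ((u - 1) * (u - 25) * (u - 49))) (by norm_num : (24:ℝ) ≠ 0) 25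
  have hb1 : (24:ℝ) * -1 + 25 = 1 := by norm_num
  have hb2 : (24:ℝ) * 0 + 25 = 25 := by norm_num
  rw [hb1, hb2] at h
  simp only [hpt, intervalIntegral.integral_const_mul, smul_eq_mul] at h
  -- h : (24 * √24)⁻¹ * ∫ x in -1..0, 1/√(x³−x) = 24⁻¹ * ∫ u in 1..25, 1/√G₁(u)
  rw [← integral_Ioc_eq_integral_Ioo, ← intervalIntegral.integral_of_le (by norm_num),
    ← integral_Ioc_eq_integral_Ioo, ← intervalIntegral.integral_of_le (by norm_num)]
  have h24 : (Real.sqrt 24) ≠ 0 := (Real.sqrt_pos.2 (by norm_num)).ne'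
  have key : ∫ u in (1:ℝ)..25, 1 / Real.sqrt ((u - 1) * (u - 25) * (u - 49)) =
      24 * ((24 * Real.sqrt 24)⁻¹ * ∫ x in (-1:ℝ)..0, 1 / Real.sqrt (x ^ 3 - x)) := by
    rw [h]; field_simp
  rw [key]
  field_simp

/-- **`V = ϖ/(2√24)`**, `ϖ = Γ(1/4)²/(2√(2π)) = ∫₋₁⁰ dx/√(x³ − x)` (tree:
`XMapKernel.Negative.integral_Ioo_neg_one_zero`). [cite: NesterenkoPhilippon2001, Ch. 1 §3 Remark ii] -/
theorem lemV_eq : ∫ x in Ioo (1:ℝ) 5, x / Real.sqrt ((x ^ 2 - 1) * (x ^ 2 - 25) * (x ^ 2 - 49)) =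
    Summit.KontsevichZagierPeriods.XMapKernel.Negative.halfLem / (2 * Real.sqrt 24) := by
  have h1 := integral_sq_substitution
  rw [integral_affine_substitution, Summit.KontsevichZagierPeriods.XMapKernel.Negative.integral_Ioo_neg_one_zero] at h1
  have h24 : (Real.sqrt 24) ≠ 0 := (Real.sqrt_pos.2 (by norm_num)).ne'
  field_simp at h1 ⊢
  linarith

/-! ### §17 Transcendence: `ϖ` is a period of the lemniscatic lattice (Huber–Wüstholz with one curve) -/

/-- **`ϖ = Γ(1/4)²/(2√(2π))` is transcendental** — Schneider's theorem for the lemniscatic curve, here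
from the tree's Huber–Wüstholz theorem with ONE curve: the lemniscatic period pair `L` (`g₂ = 4`,
`g₃ = 0`, `ω₁ = ϖ`; `exists_lemniscatic_periodPair`) and the relation `α + 1·ω₁ = 0` with `α = −ϖ`
algebraic would force `α = 0`, i.e. `ϖ = 0`. [cite: HuberWustholz2022, Thm 15.3] -/
theorem transcendental_halfLem :
    Transcendental ℚ Summit.KontsevichZagierPeriods.XMapKernel.Negative.halfLem := by
  intro halg
  obtain ⟨L, hg₂, hg₃, hω₁, -⟩ := exists_lemniscatic_periodPair
  have hw0 : 0 < Summit.KontsevichZagierPeriods.XMapKernel.Negative.halfLem :=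
    Summit.KontsevichZagierPeriods.XMapKernel.Negative.halfLem_pos
  have halgC : IsAlgebraic ℚ ((Summit.KontsevichZagierPeriods.XMapKernel.Negative.halfLem : ℝ) : ℂ) :=
    halg.algebraMap
  have h4 : IsAlgebraic ℚ (4 : ℂ) := by
    have := isAlgebraic_algebraMap (R := ℚ) (A := ℂ) (4 : ℚ)
    simpa using this
  have hinv : ∀ i : Fin 1, IsAlgebraic ℚ ((fun _ => L) i).g₂ ∧ IsAlgebraic ℚ ((fun _ => L) i).g₃ :=
    fun _ => ⟨by show IsAlgebraic ℚ L.g₂; rw [hg₂]; exact h4,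
      by show IsAlgebraic ℚ L.g₃; rw [hg₃]; exact isAlgebraic_zero⟩
  have hiso : ∀ i j : Fin 1, i ≠ j → ¬ ((fun _ => L) i).IsIsogenousTo ((fun _ => L) j) :=
    fun i j hij => absurd (Subsingleton.elim i j) hij
  have hHW := HuberWustholzManyCurvePeriods_holds 1 (fun _ => L) hinv hiso
    (-((Summit.KontsevichZagierPeriods.XMapKernel.Negative.halfLem : ℝ) : ℂ)) 0
    (fun _ => 1) (fun _ => 0) (fun _ => 0) (fun _ => 0) halgC.neg isAlgebraic_zero
    (fun _ => ⟨isAlgebraic_one, isAlgebraic_zero, isAlgebraic_zero, isAlgebraic_zero⟩) ?_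
  · have h0 := hHW.1
    rw [neg_eq_zero] at h0
    have : Summit.KontsevichZagierPeriods.XMapKernel.Negative.halfLem = 0 := by exact_mod_cast h0
    exact hw0.ne' this
  · simp only [Fin.sum_univ_one, hω₁, zero_mul, one_mul, add_zero]
    unfold Summit.KontsevichZagierPeriods.XMapKernel.Negative.halfLem
    push_cast
    ring

/-- `√24` is algebraic. [folklore] -/
theorem isAlgebraic_sqrt_24 : IsAlgebraic ℚ (Real.sqrt 24) := by
  refine ⟨Polynomial.X ^ 2 - Polynomial.C 24, Polynomial.X_pow_sub_C_ne_zero two_pos 24, ?_⟩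
  simp [Real.sq_sqrt]

/-- **`V = ∫₁⁵ x dx/√F₁` is transcendental.** [cite: HuberWustholz2022, Thm 15.3] -/
theorem transcendental_lemV :
    Transcendental ℚ (∫ x in Ioo (1:ℝ) 5, x / Real.sqrt ((x ^ 2 - 1) * (x ^ 2 - 25) * (x ^ 2 - 49))) := by
  intro hV
  apply transcendental_halfLem
  have h24 : (Real.sqrt 24) ≠ 0 := (Real.sqrt_pos.2 (by norm_num)).ne'
  have h2 : IsAlgebraic ℚ (2 : ℝ) := by
    have := isAlgebraic_algebraMap (R := ℚ) (A := ℝ) (2 : ℚ)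
    simpa using this
  have h := (hV.mul h2).mul isAlgebraic_sqrt_24
  rw [lemV_eq] at h
  have e : Summit.KontsevichZagierPeriods.XMapKernel.Negative.halfLem / (2 * Real.sqrt 24) * 2 * Real.sqrt 24 =
      Summit.KontsevichZagierPeriods.XMapKernel.Negative.halfLem := by field_simp
  rwa [e] at h


/-! ### §18 Rule (2) is load-bearing — unconditionally -/

/-- `[K₊, x/√F₁]` is a generator of the crux's sector (`G = G₁`, `q = 3`, `a₀ = 0`, `a₁ = 1`).
[cite: KontsevichZagier2001, §1.2] -/
theorem of_mem_lemRight {r : KZ.IntegralRep 1} (hd : r.domain = {p | p 0 ∈ Ioo (1:ℝ) 5})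
    (hi : r.integrand = fun p => p 0 / Real.sqrt ((p 0 ^ 2 - 1) * (p 0 ^ 2 - 25) * (p 0 ^ 2 - 49))) :
    KZ.of r ∈ {d : KZ.FormalRep | ∃ (G : Polynomial ℚ) (q a₀ a₁ : ℚ) (r : KZ.IntegralRep 1), G.natDegree = 3 ∧ Squarefree (G.comp (Polynomial.X ^ 2)) ∧ 0 < Polynomial.aeval (q : ℝ) (G.comp (Polynomial.X ^ 2)) ∧ Bornology.IsBounded (connectedComponentIn {y : ℝ | 0 < Polynomial.aeval y (G.comp (Polynomial.X ^ 2))} (q : ℝ)) ∧ r.domain = {x | x 0 ∈ connectedComponentIn {y : ℝ | 0 < Polynomial.aeval y (G.comp (Polynomial.X ^ 2))} (q : ℝ)} ∧ Set.EqOn r.integrand (fun x => ((a₀ : ℝ) + (a₁ : ℝ) * x 0) / Real.sqrt (Polynomial.aeval (x 0) (G.comp (Polynomial.X ^ 2)))) r.domain ∧ d = KZ.of r} := by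
  refine ⟨(Polynomial.C 1 * Polynomial.X ^ 3 + Polynomial.C (-75) * Polynomial.X ^ 2 + Polynomial.C 1299 * Polynomial.X + Polynomial.C (-1225) : Polynomial ℚ), 3, 0, 1, r, natDegree_G₁, squarefree_comp_G₁, ?_, ?_, ?_, ?_, rfl⟩
  · rw [aeval_F₁]; norm_num
  · rw [lemComponent_right]; exact Metric.isBounded_Ioo 1 5
  · rw [lemComponent_right, hd]
  · intro x _
    simp only [aeval_F₁, hi]
    simp

/-- `[K₋, x/√F₁]` is a generator of the crux's sector (`G = G₁`, `q = −3`, `a₀ = 0`, `a₁ = 1`).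
[cite: KontsevichZagier2001, §1.2] -/
theorem of_mem_lemLeft {r : KZ.IntegralRep 1} (hd : r.domain = {p | p 0 ∈ Ioo (-5:ℝ) (-1)})
    (hi : r.integrand = fun p => p 0 / Real.sqrt ((p 0 ^ 2 - 1) * (p 0 ^ 2 - 25) * (p 0 ^ 2 - 49))) :
    KZ.of r ∈ {d : KZ.FormalRep | ∃ (G : Polynomial ℚ) (q a₀ a₁ : ℚ) (r : KZ.IntegralRep 1), G.natDegree = 3 ∧ Squarefree (G.comp (Polynomial.X ^ 2)) ∧ 0 < Polynomial.aeval (q : ℝ) (G.comp (Polynomial.X ^ 2)) ∧ Bornology.IsBounded (connectedComponentIn {y : ℝ | 0 < Polynomial.aeval y (G.comp (Polynomial.X ^ 2))} (q : ℝ)) ∧ r.domain = {x | x 0 ∈ connectedComponentIn {y : ℝ | 0 < Polynomial.aeval y (G.comp (Polynomial.X ^ 2))} (q : ℝ)} ∧ Set.EqOn r.integrand (fun x => ((a₀ : ℝ) + (a₁ : ℝ) * x 0) / Real.sqrt (Polynomial.aeval (x 0) (G.comp (Polynomial.X ^ 2)))) r.domain ∧ d = KZ.of r} := by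
  refine ⟨(Polynomial.C 1 * Polynomial.X ^ 3 + Polynomial.C (-75) * Polynomial.X ^ 2 + Polynomial.C 1299 * Polynomial.X + Polynomial.C (-1225) : Polynomial ℚ), -3, 0, 1, r, natDegree_G₁, squarefree_comp_G₁, ?_, ?_, ?_, ?_, rfl⟩
  · rw [aeval_F₁]; norm_num
  · rw [lemComponent_left]; exact Metric.isBounded_Ioo (-5) (-1)
  · rw [lemComponent_left, hd]
  · intro x _
    simp only [aeval_F₁, hi]
    simp

/-- The restricted value of the odd pair `[K₊, x/√F₁] + [K₋, x/√F₁]` over the first-coordinate windows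
is `value r₋ = −V` (`K₊` misses `{x < 0}`, `K₋` lies inside). [folklore] -/
theorem restrictedEval_firstWindow_lemPair {r r' : KZ.IntegralRep 1} (hd : r.domain = {p | p 0 ∈ Ioo (1:ℝ) 5})
    (hd' : r'.domain = {p | p 0 ∈ Ioo (-5:ℝ) (-1)})
    (hi' : r'.integrand = fun p => p 0 / Real.sqrt ((p 0 ^ 2 - 1) * (p 0 ^ 2 - 25) * (p 0 ^ 2 - 49))) :
    KZ.restrictedEval (fun n => {x : Fin n → ℝ | ∀ i : Fin n, (i : ℕ) = 0 → x i < 0}) (KZ.of r + KZ.of r') =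
      -∫ x in Ioo (1:ℝ) 5, x / Real.sqrt ((x ^ 2 - 1) * (x ^ 2 - 25) * (x ^ 2 - 49)) := by
  rw [map_add, KZ.restrictedEval_of, KZ.restrictedEval_of]
  have hW : {x : Fin 1 → ℝ | ∀ i : Fin 1, (i : ℕ) = 0 → x i < 0} = {x | x 0 < 0} := firstWindow_succ 0
  have h1 : r.domain ∩ {x : Fin 1 → ℝ | ∀ i : Fin 1, (i : ℕ) = 0 → x i < 0} = ∅ := by
    rw [hd, hW]
    ext x
    simp only [mem_inter_iff, mem_setOf_eq, mem_Ioo, mem_empty_iff_false, iff_false, not_and, not_lt]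
    intro hx
    linarith [hx.1]
  have h2 : r'.domain ∩ {x : Fin 1 → ℝ | ∀ i : Fin 1, (i : ℕ) = 0 → x i < 0} = r'.domain := by
    rw [hW]
    refine inter_eq_left.2 fun x hx => ?_
    rw [hd'] at hx
    have hx' : x 0 ∈ Ioo (-5:ℝ) (-1) := hx
    show x 0 < 0
    linarith [hx'.2]
  rw [h1, h2, Measure.restrict_empty, integral_zero_measure, zero_add, ← lemValue_left hd' hi']
  rfl

/-- **ANY PROOF OF THE CRUX USES RULE (2), CHANGE OF VARIABLES — unconditionally.** The crux with
`KZ.relations` replaced by the subgroup generated by domain additivity (1a), integrand additivity (1b)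
and Newton–Leibniz (3) is FALSE. Witness: on the lemniscatic bielliptic curve
`y² = (x²−1)(x²−25)(x²−49)` (its odd quotient `E₁ : y² = (u−1)(u−25)(u−49)` is the quadratic twist by
`24` of `y² = x³ − x`) the odd pair `[(1,5), x/√F₁] + [(−5,−1), x/√F₁]` lies in the sector, has value
`0`, but its restricted value over the first-coordinate windows is `−V = −ϖ/(2√24)`, TRANSCENDENTAL
(`transcendental_lemV`: the tree's Huber–Wüstholz theorem on the lemniscatic lattice), whereas every
element of `closure((1a) ∪ (1b) ∪ (3))` has ALGEBRAIC restricted value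
(`isAlgebraic_restrictedEval_of_mem_closure_noCoV`). With `false_without_additivity`: any proof of
`BiellipticRealPeriodCell` uses an additivity rule AND a change of variables.
[cite: KontsevichZagier2001, §1.2] -/
theorem false_without_changeOfVariables :
    ¬ (∀ c ∈ AddSubgroup.closure {d : KZ.FormalRep | ∃ (G : Polynomial ℚ) (q a₀ a₁ : ℚ) (r : KZ.IntegralRep 1), G.natDegree = 3 ∧ Squarefree (G.comp (Polynomial.X ^ 2)) ∧ 0 < Polynomial.aeval (q : ℝ) (G.comp (Polynomial.X ^ 2)) ∧ Bornology.IsBounded (connectedComponentIn {y : ℝ | 0 < Polynomial.aeval y (G.comp (Polynomial.X ^ 2))} (q : ℝ)) ∧ r.domain = {x | x 0 ∈ connectedComponentIn {y : ℝ | 0 < Polynomial.aeval y (G.comp (Polynomial.X ^ 2))} (q : ℝ)} ∧ Set.EqOn r.integrand (fun x => ((a₀ : ℝ) + (a₁ : ℝ) * x 0) / Real.sqrt (Polynomial.aeval (x 0) (G.comp (Polynomial.X ^ 2)))) r.domain ∧ d = KZ.of r}, KZ.eval c = 0 →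
      c ∈ AddSubgroup.closure (KZ.domainAddRel ∪ KZ.integrandAddRel ∪ KZ.newtonLeibnizRel)) := fun h => by
  obtain ⟨r, hd, hi⟩ := exists_lemRepRight
  obtain ⟨r', hd', hi'⟩ := exists_lemRepLeft
  have hc : KZ.of r + KZ.of r' ∈ AddSubgroup.closure {d : KZ.FormalRep | ∃ (G : Polynomial ℚ) (q a₀ a₁ : ℚ) (r : KZ.IntegralRep 1), G.natDegree = 3 ∧ Squarefree (G.comp (Polynomial.X ^ 2)) ∧ 0 < Polynomial.aeval (q : ℝ) (G.comp (Polynomial.X ^ 2)) ∧ Bornology.IsBounded (connectedComponentIn {y : ℝ | 0 < Polynomial.aeval y (G.comp (Polynomial.X ^ 2))} (q : ℝ)) ∧ r.domain = {x | x 0 ∈ connectedComponentIn {y : ℝ | 0 < Polynomial.aeval y (G.comp (Polynomial.X ^ 2))} (q : ℝ)} ∧ Set.EqOn r.integrand (fun x => ((a₀ : ℝ) + (a₁ : ℝ) * x 0) / Real.sqrt (Polynomial.aeval (x 0) (G.comp (Polynomial.X ^ 2)))) r.domain ∧ d = KZ.of r} :=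
    add_mem (AddSubgroup.subset_closure (of_mem_lemRight hd hi)) (AddSubgroup.subset_closure (of_mem_lemLeft hd' hi'))
  have h0 : KZ.eval (KZ.of r + KZ.of r') = 0 := by
    rw [map_add, KZ.eval_of, KZ.eval_of, lemValue_right hd hi, lemValue_left hd' hi', add_neg_cancel]
  have halg := isAlgebraic_restrictedEval_of_mem_closure_noCoV (h _ hc h0)
  rw [restrictedEval_firstWindow_lemPair hd hd' hi'] at halg
  exact transcendental_lemV (by simpa using halg.neg)

end Summit.KontsevichZagierPeriods.IsogenyCertificates.BiellipticRealPeriodCellNegative
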